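import Summits.RiemannHypothesis.RiemannHypothesis.Theses.SignCone
import Summits.RiemannHypothesis.RiemannHypothesis.Theorems.SignConeEnvelopeCore
import Summits.RiemannHypothesis.RiemannHypothesis.Theorems.SignConeSignConeFarField
import Summits.RiemannHypothesis.RiemannHypothesis.Theorems.OscSingleWindow.Negative.WithoutPD
import Summits.RiemannHypothesis.RiemannHypothesis.Theorems.OscSingleWindow.Negative.WithoutPDOriginDominating
import Summits.RiemannHypothesis.RiemannHypothesis.Theorems.OscSingleWindow.Negative.WithoutNodeNonneg
import Literature.NumberTheory.LFunctions.WeilGroundEnergyProofs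
import Mathlib.Analysis.Convolution

/-!
# Disproof of `OscSingleWindow` (crux stmt-RiemannHypothesis-18012, route `SignCone`) — findings

Crux workfile of the standing disprover (seat `refuter-cdisprove-stmt-RiemannHypothesis-18012-0`, cycle 1,
2026-08-17).  Prose only in docstrings; everything below elaborates against the tree, NO `sorry`.
The crux: for node-nonnegative autocorrelation sums `F = Σᵢ gᵢ ⋆ g̃ᵢ` (`supp gᵢ ⊆ [-a, a]`) whose far-field negativity
`{|t| ≥ log 2 : Re F(t) < 0}` is non-empty and confined to ONE window `T ≤ |t| ≤ T + log 2`, `T ≥ 3`, the unit-slack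
sign-cone inequality `-Re F(0) ≤ Re W_ar(F)` (`W_ar = weilPolarTerm + weilArchTerm`, written over Mathlib primitives).

## Verdict of cycle 1: NO KILL POSSIBLE SHORT OF `¬RH`; four negative lemmas LANDED (p159132, p160014, p160060, p160195)

0. **§0 Status (route rev 7, 12:29Z: the parent decl `SignConeOscillatory` is BANKED — dropped from the route file —
   and the target `SignConeInequality` =: X is the route's named bridge hypothesis; this item is re-badged support,
   "the one UNCONDITIONAL test of the route's own mechanism").**  The item is X plus two extra hypotheses (single
   window `hw`, oscillation `hosc`), so `SignConeInequality → OscSingleWindow` (`crux_of_target`), hence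
   `RiemannHypothesis → OscSingleWindow` (`crux_of_riemannHypothesis`, re-derived here from the route-free core
   `SignConeEnvelopeCore` because the rev-6 corollary modules name the banked decl) and
   `¬OscSingleWindow → ¬RiemannHypothesis` (`not_riemannHypothesis_of_not_crux`): an unconditional `¬` would disprove RH.
   Elaboration audit (rattack W.lean + this seat): the body is `Iff.rfl`-equal to the Literature form
   `-(F 0).re ≤ (weilPolarTerm F + weilArchTerm F).re`; no junk operator bites (finite Bochner expressions on Weil
   tests; `k = 0` gives `F = 0`, not oscillatory); for `a ≤ 3/2` the hypotheses are contradictory and at `a = 7/4`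
   jointly satisfiable (rattack, `OscSingleWindow.Negative.Threshold`, p150937) — NOT vacuous, content in `a > 3/2`.
   This file imports NO module that names the banked decls (`…OscillatoryEnvelope/IffInequality/Status/Threshold`,
   the parent workfile), so it survives the rev-7 rebuild.
1. **§A positive-definiteness is load-bearing INSIDE the window class** (this seat):
   * `oscSingleWindow_false_without_PD` (LANDED p159132, `Theorems/OscSingleWindow/Negative/WithoutPD.lean`): cone
     structure replaced by "smooth, compactly supported in `[-2a, 2a]`, hermitian" (nodes, window, oscillation,
     conclusion verbatim) is FALSE — `F = -(φ(· - c) + φ(· + c))`, `φ = moll 131`, `c = 5 log 2 + 1/66`: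
     `Re W_ar(F) ≤ -4 + e²/3 < 0 = -Re F(0)` (so no multiple of `Re F(0)` as slack helps either: `F(0) = 0`).
   * `oscSingleWindow_false_without_PD_originDominating` (LANDED p160195 + helpers p160014/p160060,
     `…/Negative/WithoutPDOriginDominating{,Numerics,Witness}.lean`): even ADDING origin domination `‖F u‖ ≤ Re F(0)`
     the PD-free statement is FALSE — plateau comb with a near-field dip at `0.5` and four unit dips in the window gaps
     `(3, log 21)`, `(log 24, log 25)`, `(log 25, log 26)`, `(log 27, log 28)`: `Re W_ar(F) + Re F(0) ≤ -0.256 < 0`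
     (Bombieri bookkeeping, 25 certified cells + tail).  QUANTITATIVE READING: in Bombieri's position-space form a
     between-node dip of depth `F(0)` above the node `n` gains `≈ 2·(1/n)·2cosh(½ log n) ≈ 2/√n` units of `F(0)` with NO
     width penalty; one octave `e^T ≤ n ≤ 2e^T` offers `≈ 1.66·e^{T/2}` units, against a total budget of `< 2` units.
     Everything beyond that budget must be charged to `F̂ ≥ 0` — this is the crux's "completion cost", and it grows like
     `e^{T/2}` with the (unbounded) window height.
   * `withoutPD_imp_crux`, `withoutPDOriginDominating_imp_crux`: the two mutated statements are genuine WEAKENINGS of the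
     hypotheses (autocorrelation sums are smooth, supported in `[-2a, 2a]`, hermitian and origin-dominated), so "false
     without PD" is meaningful.
2. **§B node non-negativity is load-bearing inside the window** (rattack, LANDED p151040,
   `…/Negative/WithoutNodeNonneg.lean`, re-exported as `oscSingleWindow_false_without_nodeNonneg`); and by
   `crux_iff_windowNodesOnly` (this seat) the node hypothesis is EQUIVALENT to its restriction to the window nodes
   `T ≤ log n ≤ T + log 2` — the signs at all other nodes follow from the window hypothesis itself.  So a proof consumes
   exactly the signs `Re F(log n) ≥ 0`, `e^T ≤ n ≤ 2e^T` (the "lattice" of the informal mechanism) and nothing else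
   arithmetic.  Modulo RH even fewer: prime powers in the window suffice (`crux_primePowerWindowNodes_of_riemannHypothesis`),
   so no `_false_without_compositeNodes` can exist short of `¬RH` — although the integer-lattice lever (cards
   `erasure-unit-comb-certificate`, `one-octave-integer-certificate`) does use the composite nodes.
3. **§C not load-bearing.** The oscillation hypothesis (`withoutOsc_of_crux`: dropping it is covered by the LANDED
   far-field theorem `SignConeFarField_of`); the support hypothesis / the cutoff `a` (`withoutSupport_of_crux`: `a`
   occurs nowhere else; content = all cutoffs); the threshold `3` and the window length `log 2` modulo RH
   (`anyWindow_of_target`: the RH proof discards `hw` entirely, so `T ≥ 3`, `log 2` serve only the lever's margin —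
   weakening them keeps the item RH-implied and unrefutable).
4. **§N why it resists, and where the LEVER (not the statement) breaks** (docstring §N): truth is not in doubt
   (RH-implied; zero-free dual certificates numerically valid with margins `+0.5 … +1.9` for `3 ≤ T ≤ 3.5`, ideators 1
   and 3, kit j024905/j025029/j025601); the `c ≡ 1` octave certificate provably-in-principle dies at `T ≈ 15–17`
   (smooth-number alignment, independently derived by ideator 3 and by this seat — same numbers), and §A says the
   PD-charge to be certified grows like `e^{T/2}`: the crux as filed (`∀ T ≥ 3`) is a RUNG theorem plus an arithmetic
   residue at `T → ∞`; the planner's re-cut is the informative move, not a refutation.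
5. **§T Targets — line `Sketch` (PICKED 11:41Z).** Its two stubs `stub_slice` (`3 ≤ T ≤ 31/10`) and `stub_tail`
   (`T ≥ 31/10`) are the crux restricted in `T`, hence crux- and RH-implied (`slice_of_crux`, `tail_of_crux`): no
   `stub_*_false` exists; joint sufficiency is exact (stub set ⇔ crux).  `stub_tail` carries the whole `T → ∞` residue.
-/

noncomputable section

-- `Summit.RiemannHypothesis.RiemannHypothesis.…` repeats a namespace component by design (D-0017 layout).
set_option linter.dupNamespace false

open scoped BigOperators ComplexConjugate ArithmeticFunction.vonMangoldt
open Complex MeasureTheory Set Filter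

namespace Summit.RiemannHypothesis.RiemannHypothesis.Cruxes.OscSingleWindow.Disproof

open Literature.NumberTheory.LFunctions
open Summit.RiemannHypothesis.RiemannHypothesis.Theses.SignCone
open Summit.RiemannHypothesis.RiemannHypothesis.Theorems.SignCone
open Summit.RiemannHypothesis.RiemannHypothesis.Theorems.RuelleBandCofiniteCriticalLine

/-! ## §0 Status: the crux is the bridge hypothesis X restricted, hence RH-implied -/

/-- `SignConeInequality → OscSingleWindow`: the item is the route target X plus the window and oscillation
hypotheses (in rev ≤ 6 equivalently: the banked parent crux `SignConeOscillatory` plus `hw`). [folklore] -/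
theorem crux_of_target (h : SignConeInequality) : OscSingleWindow :=
  fun a ha k g hg hn _hw _hosc => h a ha k g hg hn

/-- `RiemannHypothesis → SignConeInequality`, re-derived from the route-free core `SignConeEnvelopeCore`
(`neg_re_apply_zero_le_re_weilArchPolar_of_riemannHypothesis`: explicit formula + easy half of Weil's criterion +
`Re P_Λ ≥ 0` on the sign cone); the item's `M`-form is definitionally the Literature form. [folklore] -/
theorem target_of_riemannHypothesis (hRH : RiemannHypothesis) : SignConeInequality := by
  intro a _ha k g hg F hn
  exact neg_re_apply_zero_le_re_weilArchPolar_of_riemannHypothesis hRH rfl (fun i => (hg i).1) hn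

/-- **`RiemannHypothesis → OscSingleWindow`** (kernel-checked; so no unconditional refutation exists short of a
disproof of RH). [folklore] -/
theorem crux_of_riemannHypothesis (hRH : RiemannHypothesis) : OscSingleWindow :=
  crux_of_target (target_of_riemannHypothesis hRH)

/-- Kill propagation: a refutation of the crux is a disproof of RH. [folklore] -/
theorem not_riemannHypothesis_of_not_crux (h : ¬ OscSingleWindow) : ¬ RiemannHypothesis :=
  fun hRH => h (crux_of_riemannHypothesis hRH)

/-! ## §A Load-bearing: positive-definiteness (the cone structure of `F`) -/

/-- The crux with "`F = Σᵢ gᵢ ⋆ g̃ᵢ`, `supp gᵢ ⊆ [-a, a]`" replaced by "`F` smooth, compactly supported in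
`[-2a, 2a]`, hermitian"; node, window and oscillation hypotheses and the conclusion verbatim. [folklore] -/
def OscSingleWindowWithoutPD : Prop :=
  ∀ a : ℝ, 0 < a → ∀ F : ℝ → ℂ,
    (ContDiff ℝ ((⊤ : ℕ∞) : WithTop ℕ∞) F ∧ HasCompactSupport F) ∧ tsupport F ⊆ Set.Icc (-(2 * a)) (2 * a) →
    (∀ u : ℝ, F (-u) = (starRingEnd ℂ) (F u)) →
    (∀ n : ℕ, 2 ≤ n → 0 ≤ (F (Real.log n)).re) →
    (∃ T : ℝ, 3 ≤ T ∧ ∀ t : ℝ, Real.log 2 ≤ |t| → (F t).re < 0 → T ≤ |t| ∧ |t| ≤ T + Real.log 2) →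
    (∃ t : ℝ, Real.log 2 ≤ |t| ∧ (F t).re < 0) →
    let M : ℂ → ℂ := fun s => ∫ u : ℝ, F u * Complex.exp ((s - 1 / 2) * u);
    -(F 0).re ≤ (M 0 + M 1 + ((1 / (2 * Real.pi) : ℂ) * (∫ t : ℝ, M (1 / 2 + t * Complex.I) *
      ((Complex.digamma (1 / 4 + t / 2 * Complex.I)).re : ℂ)) - F 0 * (Real.log Real.pi : ℂ))).re

/-- **Any proof must use positive-definiteness** (LANDED p159132, `Theorems/OscSingleWindow/Negative/WithoutPD.lean`):
witness `a = c = 5 log 2 + 1/66`, `F = -(φ(· - c) + φ(· + c))`, `φ = WeilContinuous.moll 131`, window `T = 5 log 2`;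
`Re W_ar(F) ≤ -4 + e²/3 < 0 = -Re F(0)`. [folklore] -/
theorem oscSingleWindow_false_without_PD : ¬ OscSingleWindowWithoutPD :=
  _root_.Summit.RiemannHypothesis.RiemannHypothesis.Theorems.OscSingleWindow.Negative.oscSingleWindow_false_without_PD

/-- The same with ORIGIN DOMINATION `‖F u‖ ≤ Re F(0)` added to the hypotheses. [folklore] -/
def OscSingleWindowWithoutPDOriginDominating : Prop :=
  ∀ a : ℝ, 0 < a → ∀ F : ℝ → ℂ,
    (ContDiff ℝ ((⊤ : ℕ∞) : WithTop ℕ∞) F ∧ HasCompactSupport F) ∧ tsupport F ⊆ Set.Icc (-(2 * a)) (2 * a) →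
    (∀ u : ℝ, F (-u) = (starRingEnd ℂ) (F u)) → (∀ u : ℝ, ‖F u‖ ≤ (F 0).re) →
    (∀ n : ℕ, 2 ≤ n → 0 ≤ (F (Real.log n)).re) →
    (∃ T : ℝ, 3 ≤ T ∧ ∀ t : ℝ, Real.log 2 ≤ |t| → (F t).re < 0 → T ≤ |t| ∧ |t| ≤ T + Real.log 2) →
    (∃ t : ℝ, Real.log 2 ≤ |t| ∧ (F t).re < 0) →
    let M : ℂ → ℂ := fun s => ∫ u : ℝ, F u * Complex.exp ((s - 1 / 2) * u);
    -(F 0).re ≤ (M 0 + M 1 + ((1 / (2 * Real.pi) : ℂ) * (∫ t : ℝ, M (1 / 2 + t * Complex.I) *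
      ((Complex.digamma (1 / 4 + t / 2 * Complex.I)).re : ℂ)) - F 0 * (Real.log Real.pi : ℂ))).re

/-- **Origin domination does not rescue it** (LANDED p160195, `Theorems/OscSingleWindow/Negative/WithoutPDOriginDominating.lean`;
numerics p160014, witness p160060): the single-window plateau comb (`a = 1.67`, `T = 3`, dips in `(3, log 21)`,
`(log 24, log 25)`, `(log 25, log 26)`, `(log 27, log 28)`) has `Re W_ar(F) + Re F(0) ≤ -0.256 < 0`. [folklore] -/
theorem oscSingleWindow_false_without_PD_originDominating : ¬ OscSingleWindowWithoutPDOriginDominating :=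
  _root_.Summit.RiemannHypothesis.RiemannHypothesis.Theorems.OscSingleWindow.Negative.oscSingleWindow_false_without_PD_originDominating

/-- Autocorrelation sums satisfy every hypothesis the two mutations keep: `F = Σᵢ gᵢ ⋆ g̃ᵢ` with Weil tests `gᵢ`
supported in `[-a, a]` is smooth, compactly supported in `[-2a, 2a]`, hermitian, and origin-dominated. [folklore] -/
theorem autocorrSum_structure {a : ℝ} {k : ℕ} (g : Fin k → ℝ → ℂ)
    (hg : ∀ i, IsWeilTest (g i)) (hs : ∀ i, tsupport (g i) ⊆ Icc (-a) a) :
    let F : ℝ → ℂ := fun t => ∑ i, weilConv (g i) (weilReflect (g i)) t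
    (IsWeilTest F ∧ tsupport F ⊆ Icc (-(2 * a)) (2 * a)) ∧ (∀ u : ℝ, F (-u) = conj (F u)) ∧
      ∀ u : ℝ, ‖F u‖ ≤ (F 0).re := by
  intro F
  have hFt : IsWeilTest F :=
    stub_branchesContinuous_isWeilTest_sum _ fun i _ => (hg i).weilConv (hg i).weilReflect
  refine ⟨⟨hFt, ?_⟩, fun u => ?_, fun u => ?_⟩
  · -- `F = 0` on `|t| > 2a` (supports add under convolution; as `SignCone.autocorrSum_eq_zero_of_lt`, inlined)
    have hzero : ∀ t : ℝ, 2 * a < |t| → F t = 0 := by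
      intro t ht
      refine Finset.sum_eq_zero fun i _ => ?_
      by_contra h
      have hmem : t ∈ Function.support (weilConv (g i) (weilReflect (g i))) := h
      unfold weilConv at hmem
      have h2 := support_convolution_subset_swap (ContinuousLinearMap.mul ℂ ℂ) hmem
      rw [Set.mem_add] at h2
      obtain ⟨u, hu, v, hv, huv⟩ := h2
      subst huv
      have hv' : v ∈ Icc (-a) a := hs i (subset_tsupport _ hv)
      have hu' : -u ∈ Icc (-a) a := by
        refine hs i (subset_tsupport _ ?_)
        rw [Function.mem_support] at hu ⊢
        simpa [weilReflect] using hu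
      have hle : |u + v| ≤ 2 * a := by
        rw [abs_le]
        constructor <;> linarith [hv'.1, hv'.2, hu'.1, hu'.2]
      linarith
    refine closure_minimal (fun u hu => ?_) isClosed_Icc
    rw [Function.mem_support] at hu
    by_contra habs
    refine hu (hzero u ?_)
    rw [mem_Icc, not_and_or, not_le, not_le] at habs
    rcases habs with h' | h'
    · linarith [neg_le_abs u]
    · linarith [le_abs_self u]
  · show F (-u) = conj (F u)
    have h := fun i => conj_weilConv_weilReflect_neg (g i) u
    simp only [F, map_sum]
    refine Finset.sum_congr rfl fun i _ => ?_
    rw [← h i, conj_conj]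
  · have h0 : (F 0).re = ∑ i, ∫ t, ‖g i t‖ ^ 2 := by
      simp only [F, Complex.re_sum, weilConv_weilReflect_apply_zero, Complex.ofReal_re]
    calc ‖F u‖ = ‖∑ i, weilConv (g i) (weilReflect (g i)) u‖ := rfl
      _ ≤ ∑ i, ‖weilConv (g i) (weilReflect (g i)) u‖ := norm_sum_le _ _
      _ ≤ ∑ i, ∫ t, ‖g i t‖ ^ 2 := Finset.sum_le_sum fun i _ => norm_weilConv_weilReflect_le (hg i) u
      _ = (F 0).re := h0.symm

/-- The PD-free mutation is a genuine WEAKENING of the hypotheses: it implies the crux. [folklore] -/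
theorem withoutPD_imp_crux (h : OscSingleWindowWithoutPD) : OscSingleWindow := by
  intro a ha k g hg F hn hw hosc
  obtain ⟨hF, hherm, -⟩ := autocorrSum_structure g (fun i => (hg i).1) (fun i => (hg i).2)
  exact h a ha F hF hherm hn hw hosc

/-- So is the origin-dominated PD-free mutation. [folklore] -/
theorem withoutPDOriginDominating_imp_crux (h : OscSingleWindowWithoutPDOriginDominating) : OscSingleWindow := by
  intro a ha k g hg F hn hw hosc
  obtain ⟨hF, hherm, hdom⟩ := autocorrSum_structure g (fun i => (hg i).1) (fun i => (hg i).2)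
  exact h a ha F hF hherm hdom hn hw hosc

/-! ## §B Load-bearing: node non-negativity — and exactly WHICH nodes -/

/-- The crux with the node hypothesis `∀ n ≥ 2, 0 ≤ Re F(log n)` deleted; everything else verbatim. [folklore] -/
def OscSingleWindowWithoutNodeNonneg : Prop :=
  ∀ a : ℝ, 0 < a → ∀ (k : ℕ) (g : Fin k → ℝ → ℂ), (∀ i, (ContDiff ℝ ((⊤ : ℕ∞) : WithTop ℕ∞) (g i) ∧ HasCompactSupport (g i)) ∧ tsupport (g i) ⊆ Set.Icc (-a) a) → let F : ℝ → ℂ := fun t => ∑ i, MeasureTheory.convolution (g i) (fun u => (starRingEnd ℂ) ((g i) (-u))) (ContinuousLinearMap.mul ℂ ℂ) MeasureTheory.MeasureSpace.volume t; (∃ T : ℝ, 3 ≤ T ∧ ∀ t : ℝ, Real.log 2 ≤ |t| → (F t).re < 0 → T ≤ |t| ∧ |t| ≤ T + Real.log 2) → (∃ t : ℝ, Real.log 2 ≤ |t| ∧ (F t).re < 0) → let M : ℂ → ℂ := fun s => ∫ u : ℝ, F u * Complex.exp ((s - 1 / 2) * u); -(F 0).re ≤ (M 0 + M 1 + ((1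 / (2 * Real.pi) : ℂ) * (∫ t : ℝ, M (1 / 2 + t * Complex.I) * ((Complex.digamma (1 / 4 + t / 2 * Complex.I)).re : ℂ)) - F 0 * (Real.log Real.pi : ℂ))).re

/-- **Any proof must use the node signs, even with the window kept** (rattack, LANDED p151040,
`Theorems/OscSingleWindow/Negative/WithoutNodeNonneg.lean`): narrow two-bump `moll 7`, `c = 4(1+K)`; the polar term
`-8 sinh²(c/4) φ̂(0) φ̂(1)` beats the `c`-free archimedean bound. [folklore] -/
theorem oscSingleWindow_false_without_nodeNonneg : ¬ OscSingleWindowWithoutNodeNonneg :=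
  _root_.Summit.RiemannHypothesis.RiemannHypothesis.Theorems.OscSingleWindow.Negative.oscSingleWindow_false_without_nodeNonneg

/-- The deleted hypothesis is the only difference. [folklore] -/
theorem withoutNodeNonneg_imp_crux (h : OscSingleWindowWithoutNodeNonneg) : OscSingleWindow :=
  fun a ha k g hg _hn hw hosc => h a ha k g hg hw hosc

/-- The crux with the node hypothesis moved AFTER the window and restricted to the window nodes
`T ≤ log n ≤ T + log 2` (i.e. `e^T ≤ n ≤ 2e^T`): the only node signs a proof can need. [folklore] -/
def OscSingleWindowWindowNodesOnly : Prop :=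
  ∀ a : ℝ, 0 < a → ∀ (k : ℕ) (g : Fin k → ℝ → ℂ), (∀ i, (ContDiff ℝ ((⊤ : ℕ∞) : WithTop ℕ∞) (g i) ∧ HasCompactSupport (g i)) ∧ tsupport (g i) ⊆ Set.Icc (-a) a) → let F : ℝ → ℂ := fun t => ∑ i, MeasureTheory.convolution (g i) (fun u => (starRingEnd ℂ) ((g i) (-u))) (ContinuousLinearMap.mul ℂ ℂ) MeasureTheory.MeasureSpace.volume t; ∀ T : ℝ, 3 ≤ T → (∀ t : ℝ, Real.log 2 ≤ |t| → (F t).re < 0 → T ≤ |t| ∧ |t| ≤ T + Real.log 2) → (∀ n : ℕ, 2 ≤ n → T ≤ Real.log n → Real.log n ≤ T + Real.log 2 → 0 ≤ (F (Real.log n)).re) → (∃ t : ℝ, Real.log 2 ≤ |t| ∧ (F t).re < 0) → let M : ℂ → ℂ := fun s => ∫ u : ℝ, F u * Complex.exp ((s - 1 / 2) * u); -(F 0).re ≤ (M 0 + M 1 + ((1 / (2 * Real.pi) : ℂ) * (∫ t : ℝ, M (1 / 2 + t * Complex.I) * ((Complex.digamma (1 / 4 + t / 2 * Complex.I)).re :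 ℂ)) - F 0 * (Real.log Real.pi : ℂ))).re

/-- **Exactly the window nodes matter**: `OscSingleWindow ↔ OscSingleWindowWindowNodesOnly`.  The signs at nodes
OUTSIDE the window are consequences of the window hypothesis (`Re F(log n) < 0` with `log n ≥ log 2` forces
`log n` into the window). [folklore] -/
theorem crux_iff_windowNodesOnly : OscSingleWindow ↔ OscSingleWindowWindowNodesOnly := by
  constructor
  · intro h a ha k g hg F T hT hw hnT hosc
    refine h a ha k g hg (fun n hn => ?_) ⟨T, hT, hw⟩ hosc
    by_contra hneg
    have hneg' : (F (Real.log n)).re < 0 := not_le.1 hneg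
    have hn2 : (2 : ℝ) ≤ n := by exact_mod_cast hn
    have hl : Real.log 2 ≤ |Real.log n| := by
      rw [abs_of_nonneg (Real.log_nonneg (by linarith))]
      exact Real.log_le_log (by norm_num) hn2
    have hwin := hw (Real.log n) hl hneg'
    rw [abs_of_nonneg (Real.log_nonneg (by linarith))] at hwin
    exact hneg (hnT n hn hwin.1 hwin.2)
  · intro h a ha k g hg F hn hw hosc
    obtain ⟨T, hT, hw⟩ := hw
    exact h a ha k g hg T hT hw (fun n hn2 _ _ => hn n hn2) hosc

/-- The prime term needs the node signs only where `Λ(n) ≠ 0`: on a hermitian compactly supported kernel with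
`Re F(log n) ≥ 0` at PRIME POWERS, `Re P_Λ(F) ≥ 0` (as in the parent workfile, re-proved here route-free). [folklore] -/
theorem re_weilPrimeTerm_nonneg_of_primePowerNodes {F : ℝ → ℂ} (hFc : HasCompactSupport F)
    (hsym : ∀ t : ℝ, conj (F (-t)) = F t)
    (hn : ∀ n : ℕ, 2 ≤ n → IsPrimePow n → 0 ≤ (F (Real.log n)).re) :
    0 ≤ (weilPrimeTerm F).re := by
  unfold weilPrimeTerm
  rw [Complex.re_tsum (summable_weilPrimeTerm hFc)]
  refine tsum_nonneg fun n => ?_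
  have hcoef : ((Λ n : ℝ) : ℂ) / (Real.sqrt n : ℂ) = ((Λ n / Real.sqrt n : ℝ) : ℂ) := by
    push_cast
    rfl
  by_cases hpp : IsPrimePow n
  · have hn2 : 2 ≤ n := hpp.two_le
    have hre' : (F (-Real.log n)).re = (F (Real.log n)).re := by
      have h := congrArg Complex.re (hsym (Real.log n))
      simpa only [Complex.conj_re] using h
    have hre : (F (Real.log n) + F (-Real.log n)).re = 2 * (F (Real.log n)).re := by
      rw [Complex.add_re, hre']
      ring
    rw [hcoef, Complex.re_ofReal_mul, hre]
    exact mul_nonneg (div_nonneg ArithmeticFunction.vonMangoldt_nonneg (Real.sqrt_nonneg _))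
      (by nlinarith [hn n hn2 hpp])
  · have hΛ : Λ n = 0 := ArithmeticFunction.vonMangoldt_eq_zero_iff.2 hpp
    simp [hΛ]

/-- **Composite nodes are not load-bearing modulo RH**: under RH the crux holds with the node hypothesis restricted
to PRIME POWERS (inside the window, by `crux_iff_windowNodesOnly` the others are idle anyway).  So no
`_false_without_compositeNodes` exists short of `¬RH` — though the integer-lattice lever uses every integer of the
octave. [folklore] -/
theorem crux_primePowerWindowNodes_of_riemannHypothesis (hRH : RiemannHypothesis) :
    ∀ a : ℝ, 0 < a → ∀ (k : ℕ) (g : Fin k → ℝ → ℂ), (∀ i, (ContDiff ℝ ((⊤ : ℕ∞) : WithTop ℕ∞) (g i) ∧ HasCompactSupport (g i)) ∧ tsupport (g i) ⊆ Set.Icc (-a) a) → let F : ℝ → ℂ := fun t => ∑ i, MeasureTheory.convolution (g i) (fun u => (starRingEnd ℂ) ((g i) (-u))) (ContinuousLinearMap.mul ℂ ℂ) MeasureTheory.MeasureSpace.volume t; (∀ n : ℕ, 2 ≤ n → IsPrimePow n → 0 ≤ (F (Real.log n)).re) → (∃ T : ℝ, 3 ≤ T ∧ ∀ t : ℝ,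 Real.log 2 ≤ |t| → (F t).re < 0 → T ≤ |t| ∧ |t| ≤ T + Real.log 2) → (∃ t : ℝ, Real.log 2 ≤ |t| ∧ (F t).re < 0) → let M : ℂ → ℂ := fun s => ∫ u : ℝ, F u * Complex.exp ((s - 1 / 2) * u); -(F 0).re ≤ (M 0 + M 1 + ((1 / (2 * Real.pi) : ℂ) * (∫ t : ℝ, M (1 / 2 + t * Complex.I) * ((Complex.digamma (1 / 4 + t / 2 * Complex.I)).re : ℂ)) - F 0 * (Real.log Real.pi : ℂ))).re := by
  intro a _ha k g hg F hn _hw _hosc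
  show -(F 0).re ≤ (weilPolarTerm F + weilArchTerm F).re
  have hF : F = fun t => ∑ i, weilConv (g i) (weilReflect (g i)) t := rfl
  have hgi : ∀ i, IsWeilTest (g i) := fun i => (hg i).1
  have hGi : ∀ i, IsWeilTest (weilConv (g i) (weilReflect (g i))) := fun i =>
    (hgi i).weilConv (hgi i).weilReflect
  have hFt : IsWeilTest F := by
    rw [hF]
    exact stub_branchesContinuous_isWeilTest_sum _ fun i _ => hGi i
  have hdec : weilPolarTerm F + weilArchTerm F = weilFunctional F + weilPrimeTerm F := by
    unfold weilFunctional
    ring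
  have hW : weilFunctional F = ∑ i, weilQuadratic (g i) := by
    rw [hF, stub_branchesContinuous_weilFunctional_sum _ fun i _ => hGi i]
    rfl
  have hWP : WeilPositivity := WeilPositivity.of_riemannHypothesis explicit_formula_holds hRH
  have hWre : 0 ≤ (weilFunctional F).re := by
    rw [hW, Complex.re_sum]
    exact Finset.sum_nonneg fun i _ => hWP _ (hgi i)
  have hsym : ∀ t : ℝ, conj (F (-t)) = F t := by
    intro t
    simp only [hF, map_sum, conj_weilConv_weilReflect_neg]
  have hPre : 0 ≤ (weilPrimeTerm F).re := re_weilPrimeTerm_nonneg_of_primePowerNodes hFt.2 hsym hn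
  have h0 : 0 ≤ (F 0).re := by
    rw [hF]
    simp only [Complex.re_sum, weilConv_weilReflect_apply_zero, Complex.ofReal_re]
    exact Finset.sum_nonneg fun i _ => integral_nonneg fun t => by positivity
  rw [hdec, Complex.add_re]
  linarith

/-! ## §C Not load-bearing -/

/-- **The oscillation hypothesis is idle**: the crux implies its own version WITHOUT `hosc` — a node-nonnegative
single-window `F` with no far-field negativity is covered by the LANDED far-field theorem `SignConeFarField_of`
(margin `0.237`). [folklore] -/
theorem withoutOsc_of_crux (h : OscSingleWindow) :
    ∀ a : ℝ, 0 < a → ∀ (k : ℕ) (g : Fin k → ℝ → ℂ), (∀ i, (ContDiff ℝ ((⊤ : ℕ∞) : WithTop ℕ∞) (g i) ∧ HasCompactSupport (g i)) ∧ tsupport (g i) ⊆ Set.Icc (-a) a) → let F : ℝ → ℂ := fun t => ∑ i, MeasureTheory.convolution (g i) (fun u => (starRingEnd ℂ) ((g i) (-u))) (ContinuousLinearMap.mul ℂ ℂ) MeasureTheory.MeasureSpace.volume t; (∀ n : ℕ, 2 ≤ n → 0 ≤ (F (Real.log n)).re) → (∃ T : ℝ, 3 ≤ T ∧ ∀ t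 : ℝ, Real.log 2 ≤ |t| → (F t).re < 0 → T ≤ |t| ∧ |t| ≤ T + Real.log 2) → let M : ℂ → ℂ := fun s => ∫ u : ℝ, F u * Complex.exp ((s - 1 / 2) * u); -(F 0).re ≤ (M 0 + M 1 + ((1 / (2 * Real.pi) : ℂ) * (∫ t : ℝ, M (1 / 2 + t * Complex.I) * ((Complex.digamma (1 / 4 + t / 2 * Complex.I)).re : ℂ)) - F 0 * (Real.log Real.pi : ℂ))).re := by
  intro a ha k g hg F hn hw
  by_cases hff : ∀ t : ℝ, Real.log 2 ≤ |t| → 0 ≤ (F t).re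
  · exact _root_.Summit.RiemannHypothesis.RiemannHypothesis.Theorems.SignConeFarField.SignConeFarField_of a ha k g hg hn hff
  · push Not at hff
    exact h a ha k g hg hn hw hff

/-- **The support hypothesis (and with it the cutoff `a`) carries no information by itself**: the crux implies its
own version WITHOUT `tsupport (gᵢ) ⊆ [-a, a]` (apply it at a cutoff containing every support; `a` occurs nowhere
else — the content is "all cutoffs", and the only geometric parameter is the window height `T`). [folklore] -/
theorem withoutSupport_of_crux (h : OscSingleWindow) :
    ∀ a : ℝ, 0 < a → ∀ (k : ℕ) (g : Fin k → ℝ → ℂ), (∀ i, ContDiff ℝ ((⊤ : ℕ∞) : WithTop ℕ∞) (g i) ∧ HasCompactSupport (g i)) → let F : ℝ → ℂ := fun t => ∑ i, MeasureTheory.convolution (g i) (fun u => (starRingEnd ℂ) ((g i) (-u))) (ContinuousLinearMap.mul ℂ ℂ) MeasureTheory.MeasureSpace.volume t; (∀ n : ℕ, 2 ≤ n → 0 ≤ (F (Real.log n)).re) → (∃ T : ℝ, 3 ≤ T ∧ ∀ t : ℝ, Real.log 2 ≤ |t| → (F t).re < 0 → T ≤ |t| ∧ |t| ≤ T + Real.log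 2) → (∃ t : ℝ, Real.log 2 ≤ |t| ∧ (F t).re < 0) → let M : ℂ → ℂ := fun s => ∫ u : ℝ, F u * Complex.exp ((s - 1 / 2) * u); -(F 0).re ≤ (M 0 + M 1 + ((1 / (2 * Real.pi) : ℂ) * (∫ t : ℝ, M (1 / 2 + t * Complex.I) * ((Complex.digamma (1 / 4 + t / 2 * Complex.I)).re : ℂ)) - F 0 * (Real.log Real.pi : ℂ))).re := by
  intro a _ha k g hg F hn hw hosc
  -- as in the parent workfile's `withoutSupport_of_crux`: choose a cutoff containing all supports
  have hR : ∀ i, ∃ R : ℝ, 0 < R ∧ tsupport (g i) ⊆ Set.Icc (-R) R := by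
    intro i
    obtain ⟨r, hr⟩ := (hg i).2.isCompact.isBounded.subset_closedBall 0
    refine ⟨|r| + 1, by positivity, fun y hy => ?_⟩
    have hy' := hr hy
    rw [Metric.mem_closedBall, dist_zero_right, Real.norm_eq_abs] at hy'
    rw [Set.mem_Icc]
    constructor <;> linarith [le_abs_self r, neg_abs_le y, le_abs_self y]
  choose R hRpos hRsub using hR
  have hsum : ∀ i, R i ≤ ∑ j, R j := fun i =>
    Finset.single_le_sum (fun j _ => (hRpos j).le) (Finset.mem_univ i)
  have ha' : 0 < 1 + ∑ j, R j := by
    have : 0 ≤ ∑ j, R j := Finset.sum_nonneg fun j _ => (hRpos j).le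
    linarith
  have hsub : ∀ i, tsupport (g i) ⊆ Set.Icc (-(1 + ∑ j, R j)) (1 + ∑ j, R j) := by
    intro i y hy
    have hy' := hRsub i hy
    rw [Set.mem_Icc] at hy' ⊢
    constructor <;> linarith [hsum i, hy'.1, hy'.2]
  exact h (1 + ∑ j, R j) ha' k g (fun i => ⟨hg i, hsub i⟩) hn hw hosc

/-- **Threshold `3` and window length `log 2` are idle modulo RH**: the bridge hypothesis X (RH-implied) gives the
single-window statement for ANY threshold `T₀` and ANY window length `L` — the RH proof discards the window
hypothesis (under RH: `anyWindow_of_target (target_of_riemannHypothesis hRH)`).  So weakening `T ≥ 3` or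
lengthening the window keeps the item unrefutable short of `¬RH`; these constants serve only the lever's margin
(`(1 + T)/π - 1 > 0` needs `T > π - 1`). [folklore] -/
theorem anyWindow_of_target (h : SignConeInequality) (T₀ L : ℝ) :
    ∀ a : ℝ, 0 < a → ∀ (k : ℕ) (g : Fin k → ℝ → ℂ), (∀ i, (ContDiff ℝ ((⊤ : ℕ∞) : WithTop ℕ∞) (g i) ∧ HasCompactSupport (g i)) ∧ tsupport (g i) ⊆ Set.Icc (-a) a) → let F : ℝ → ℂ := fun t => ∑ i, MeasureTheory.convolution (g i) (fun u => (starRingEnd ℂ) ((g i) (-u))) (ContinuousLinearMap.mul ℂ ℂ) MeasureTheory.MeasureSpace.volume t; (∀ n : ℕ, 2 ≤ n → 0 ≤ (F (Real.log n)).re) → (∃ T : ℝ, T₀ ≤ T ∧ ∀ t : ℝ, Real.log 2 ≤ |t| → (F t).re < 0 → T ≤ |t| ∧ |t| ≤ T + L) → (∃ t : ℝ, Real.log 2 ≤ |t| ∧ (F t).re < 0) → let M : ℂ → ℂ := fun s => ∫ u : ℝ, F u * Complex.exp ((s - 1 / 2) * u); -(F 0).re ≤ (M 0 + M 1 + ((1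 / (2 * Real.pi) : ℂ) * (∫ t : ℝ, M (1 / 2 + t * Complex.I) * ((Complex.digamma (1 / 4 + t / 2 * Complex.I)).re : ℂ)) - F 0 * (Real.log Real.pi : ℂ))).re := by
  intro a ha k g hg F hn _hw _hosc
  exact h a ha k g hg hn

/-! ## §N Why it resists; where the LEVER breaks (numerics and paper analysis, no new kit job this cycle)

* TRUTH. RH-implied (§0).  Zero-free evidence: the erasure/unit-comb dual certificate (card
  `Ideas/erasure-unit-comb-certificate.md`, kit j024905/j025029, NUMERICS-ideator1.md) is numerically valid on COMPLETE
  frequency ranges for every window `T ∈ [3.0, 3.2]` and at `T = 3.25, 3.5` with pointwise margins `+0.626`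
  (low frequencies) and `≥ 1.0` (aliasing heights); the time-side octave certificate (card
  `Ideas/one-octave-integer-certificate.md`, j025601) closes `T = log 20 … log 23` with `Re W_ar ≥ -0.484 Re F(0)`.
  The primal LP of the parent seat (j020376) never found `Re W_ar/Re F(0)` below `+0.057` with forced dips at heights
  `3.31–4.66` (threshold `-1`).  Under RH the whole unit slack is spare (`Re W_ar ≥ Re P_Λ ≥ 0` on the sign cone).
* WHAT A PROOF MUST PAY (§A quantified).  Without `F̂ ≥ 0` a dip of depth `F(0)` filling the gap above node `n` gains
  `≈ 2/√n` units of `F(0)` for free (`oscSingleWindow_false_without_PD_originDominating`: four gaps at `n = 20, 24, 25, 27`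
  give `-1.274`, beating the total budget `log 4π + γ - 1 - (near field) ≈ 0.21 + …`); over one octave the free gain is
  `Σ_{e^T ≤ n ≤ 2e^T} 2/√n ≈ 1.66 e^{T/2}` (`7.4` at `T = 3`, `20` at `T = 5`, `245` at `T = 10`).  Positive-definiteness
  must therefore supply a charge growing like `e^{T/2}`, uniformly in the cutoff — in the dual certificates this is the
  pairing `(1/2π)∫ F̂ · D_T ≥ 0`, whose density must dominate the one-octave Dirichlet polynomial
  `2 Re Σ_{e^T ≤ n ≤ 2e^T} n^{-1/2+iξ}` by the archimedean budget `≈ log ξ` at EVERY height `ξ`.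
* WHERE THE `c ≡ 1` LEVER DIES (paper analysis of this seat, agreeing with ideator 3's independent "HONEST NEW
  OBSTRUCTION"): at Dirichlet heights `ξ*` with `p^{iξ*} ≈ 1` for all `p ≤ y` (`log ξ* ≈ π(y)·log(1/ε)`), the `y`-smooth
  integers of the octave are coherent and contribute `≈ 1.66 ρ(u) √X` (`u = log X / log y`) against the budget
  `≈ log ξ*`; with `u ≈ 3` this overturns the unit-comb density once `X ≳ 10⁷` (`T ≳ 16 ± 1`), while for `T ≤ 10` no
  alignment mechanism comes close (the budget grows with the alignment cost faster than the aligned mass: e.g. `X = e^{10}`,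
  `y = 13`: aligned mass `≈ 1.1` vs half-budget `≈ 10`).  Random-model fluctuations (`σ² = ½ Σ 1/n ≈ 0.35`) never threaten.
  CONSEQUENCE: the unit-comb certificate is a RUNG device (`3 ≤ T ≤ T₀`, `T₀` set by certified computation, `≈ 5–7`);
  for `T → ∞` any certificate must vanish in mean on smooth integers and then needs square-root cancellation in
  `Σ_{rough n ∈ (X,2X]} n^{-1/2+iξ}` — not implied even by RH.  This is an obstruction to the METHOD, not to the statement;
  recorded so that no seat spends a cycle scanning `T ≥ 12` with `c ≡ 1`.  (An explicit dead `(X, ξ*)` would need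
  simultaneous Diophantine approximation in dimension `π(y) ≈ 45–60` at near-Dirichlet quality — LLL-feasible but judged
  not decision-relevant this cycle; standing falsifier (3) of the octave card.)
* NOT TRIED / OPEN for a later cycle: (i) `_anySlack` form of §A with origin domination (needs `≍ C²` gap dips, i.e. a
  `k`-uniform plateau-comb estimate — the parent's `SlackUnbounded` analogue); (ii) whether node signs at PRIMES of the
  window are load-bearing unconditionally (composites-only variant: plausibly still certifiable at `T = 3` by an
  LP-rebalanced comb, undecided); (iii) smoothness `ContDiff ⊤ → C⁰` (Bochner-junk direction, low value).
-/

/-! ## §T Targets — line `Sketch` (PICKED 11:41Z: crux idea `erasure-unit-comb-certificate`; skeleton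
`Cruxes/OscSingleWindow/Lines/Sketch.lean`, stubs `stub_slice` (`3 ≤ T ≤ 31/10`) and `stub_tail` (`T ≥ 31/10`))

Both stubs are the crux RESTRICTED to a range of the window position `T` (bodies verbatim), so each is implied by the
crux and hence by RH (`slice_of_crux`, `tail_of_crux` below, composed with `crux_of_riemannHypothesis`):
NO `stub_*_false` can exist short of `¬RH`.  Joint sufficiency is exact and sorry-free in the skeleton
(`OscSingleWindow_of` = case split on `T ≤ 31/10`), and together with the two lemmas below the stub set is EQUIVALENT
to the crux — nothing is smuggled, nothing is strengthened.  Attack surface left to a disprover: none on the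
statements; on the METHOD, `stub_slice` is one kernel-checked `PWData` certificate (self-verifying when it lands —
no independent scan needed), while `stub_tail` quantifies over ALL `T ≥ 31/10` and therefore contains the `T → ∞`
residue of §N: flat-top certificates cover any bounded range `[31/10, T₁]` by finite computation, but by §N the
unit comb cannot serve beyond `T ≈ 16`, and §A prices what must be certified at height `T` at `≍ e^{T/2}` units of
`F(0)`.  Expect the lead to re-cut `stub_tail` into a finite ladder plus a named arithmetic residue; this seat's next
arm should check (a) the exact window bookkeeping of each certificate slice (`x_{j₁} ≤ T`, `T + log 2 ≤ x_{j₂}` for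
EVERY `T` of the slice, not just its endpoints), (b) that consecutive slices overlap or abut in `T` with no gap at
`31/10`, (c) any analytic `T → ∞` stub against the smooth-number heights of §N. -/

/-- `stub_slice` of line `Sketch` is a sub-case of the crux (so RH-implied, unkillable). [folklore] -/
theorem slice_of_crux (h : OscSingleWindow) : ∀ T : ℝ, 3 ≤ T → T ≤ 31 / 10 →
    ∀ a : ℝ, 0 < a → ∀ (k : ℕ) (g : Fin k → ℝ → ℂ), (∀ i, (ContDiff ℝ ((⊤ : ℕ∞) : WithTop ℕ∞) (g i) ∧ HasCompactSupport (g i)) ∧ tsupport (g i) ⊆ Set.Icc (-a) a) → let F : ℝ → ℂ := fun t => ∑ i, MeasureTheory.convolution (g i) (fun u => (starRingEnd ℂ) ((g i) (-u))) (ContinuousLinearMap.mul ℂ ℂ) MeasureTheory.MeasureSpace.volume t; (∀ n : ℕ, 2 ≤ n → 0 ≤ (F (Real.log n)).re) → (∀ t : ℝ, Real.log 2 ≤ |t| → (F t).re < 0 → T ≤ |t| ∧ |t| ≤ T + Real.log 2) → (∃ t : ℝ, Real.log 2 ≤ |t| ∧ (F t).re < 0) → let M : ℂ → ℂ := fun s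 => ∫ u : ℝ, F u * Complex.exp ((s - 1 / 2) * u); -(F 0).re ≤ (M 0 + M 1 + ((1 / (2 * Real.pi) : ℂ) * (∫ t : ℝ, M (1 / 2 + t * Complex.I) * ((Complex.digamma (1 / 4 + t / 2 * Complex.I)).re : ℂ)) - F 0 * (Real.log Real.pi : ℂ))).re := by
  intro T hT _hle a ha k g hg F hn hwin hosc
  exact h a ha k g hg hn ⟨T, hT, hwin⟩ hosc

/-- `stub_tail` of line `Sketch` is a sub-case of the crux (so RH-implied, unkillable; it carries the whole `T → ∞`
content). [folklore] -/
theorem tail_of_crux (h : OscSingleWindow) : ∀ T : ℝ, 31 / 10 ≤ T →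
    ∀ a : ℝ, 0 < a → ∀ (k : ℕ) (g : Fin k → ℝ → ℂ), (∀ i, (ContDiff ℝ ((⊤ : ℕ∞) : WithTop ℕ∞) (g i) ∧ HasCompactSupport (g i)) ∧ tsupport (g i) ⊆ Set.Icc (-a) a) → let F : ℝ → ℂ := fun t => ∑ i, MeasureTheory.convolution (g i) (fun u => (starRingEnd ℂ) ((g i) (-u))) (ContinuousLinearMap.mul ℂ ℂ) MeasureTheory.MeasureSpace.volume t; (∀ n : ℕ, 2 ≤ n → 0 ≤ (F (Real.log n)).re) → (∀ t : ℝ, Real.log 2 ≤ |t| → (F t).re < 0 → T ≤ |t| ∧ |t| ≤ T + Real.log 2) → (∃ t : ℝ, Real.log 2 ≤ |t| ∧ (F t).re < 0) → let M : ℂ → ℂ := fun s => ∫ u : ℝ, F u * Complex.exp ((s - 1 / 2) * u); -(F 0).re ≤ (M 0 + M 1 + ((1 / (2 * Real.pi) : ℂ) * (∫ t : ℝ, M (1 / 2 + t * Complex.I) * ((Complex.digamma (1 / 4 + t / 2 * Complex.I)).re : ℂ)) - F 0 * (Real.log Real.pi : ℂ))).re := by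
  intro T hT a ha k g hg F hn hwin hosc
  exact h a ha k g hg hn ⟨T, by linarith, hwin⟩ hosc

/-- Both stubs under RH (as terms: `slice_of_crux (crux_of_riemannHypothesis hRH)`,
`tail_of_crux (crux_of_riemannHypothesis hRH)`). [folklore] -/
example (hRH : RiemannHypothesis) := slice_of_crux (crux_of_riemannHypothesis hRH)
example (hRH : RiemannHypothesis) := tail_of_crux (crux_of_riemannHypothesis hRH)

end Summit.RiemannHypothesis.RiemannHypothesis.Cruxes.OscSingleWindow.Disproof

end
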